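import Summits.ResolutionOfSingularities.ResolutionOfSingularities.Theorems.SurfacePort
import Literature.AlgebraicGeometry.Resolution.NearChainTerminationETwoScheme
import HarnessLib

/-!
# SurfacePortBridge — the port `SurfaceChainPort` IS the Literature fact CJS 2020 Thm. 6.40, by `Iff.rfl`
# (decomp-res node «SurfacePort», lens-4 g31 pin b367c4d1, critic row 182 CLEARED DECIDED-MOD-PORT(M+) +1; tree file 4/4 of the node)

Critic rider INBOX :909 (A): the Theses-cone / free files of the node may carry `surfaceChainPort_iff_CJS2020 : SurfaceChainPort ↔
Literature.….CJS2020_noInfiniteNearChain_eTwo := Iff.rfl` ONLY once the statement-only Literature twin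
`Literature/AlgebraicGeometry/Resolution/NearChainTerminationETwoScheme.lean` (lens-4 g31 `lit/` pin c694db9b; `--kind definition --cite
"CossartJannsenSaito2020, Thm. 6.40 / Def. 6.38–6.39 pp. 103–104"`) is ACCEPTED — it was (p811841, reviewed), after `MaxContactCutSurfacePort`
(p812007) had been proposed without the line; hence this separate 3-line bridge (cone-free: imports `SurfacePort` + the Literature twin only).
With it the port hypothesis `(h640 : SurfaceChainPort)` of `noWildWallFreeFreshJumpShallowCompanionKangarooTowers_iff_g31` and of the four
`…_iff_g31 (h71) (h640)` corollaries is DISCHARGED BY NAME from the cited fact (row 182: MAP 0 → the surface column is decided modulo a LITERATURE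
FACT, exactly as the lens-3 NearCut column's `NearChainPort` ↔ `NearChainTerminationETwo.CJS2020_noInfiniteNearChain_eTwo` via `NearCutPortBridge`).

(Sources: CossartJannsenSaito2020 Thm. 6.40, Def. 6.38–6.39 pp. 103–104, Thm. 6.35, Cor. 6.37; CossartPiltant2008 §2; Hironaka1964 Ch. III.)
-/

namespace Summit.ResolutionOfSingularities.ResolutionOfSingularities.Theorems.HugValuationCut

/-- **THE PORT IS THE LITERATURE FACT, BY `Iff.rfl`**: `SurfaceChainPort` (no infinite chain of length-one fundamental units at isolated closed
points of an embedded excellent hypersurface surface, scheme rendering) is the SAME TERM as the cited fact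
`Literature.AlgebraicGeometry.Resolution.CJS2020_noInfiniteNearChain_eTwo`. [CossartJannsenSaito2020, Thm. 6.40] -/
theorem surfaceChainPort_iff_CJS2020 :
    SurfaceChainPort ↔ Literature.AlgebraicGeometry.Resolution.CJS2020_noInfiniteNearChain_eTwo := Iff.rfl

/-- Hence the port is DISCHARGED by the cited fact used as a hypothesis BY NAME. [CossartJannsenSaito2020, Thm. 6.40] -/
theorem surfaceChainPort_of_CJS2020 (h : Literature.AlgebraicGeometry.Resolution.CJS2020_noInfiniteNearChain_eTwo) :
    SurfaceChainPort := surfaceChainPort_iff_CJS2020.mpr h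

end Summit.ResolutionOfSingularities.ResolutionOfSingularities.Theorems.HugValuationCut
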